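import Mathlib
import Literature.MathematicalPhysics.QuantumFieldTheory.Balaban1983to89.B4
import Literature.MathematicalPhysics.QuantumFieldTheory.Balaban1983to89.QGQInverse
import Literature.MathematicalPhysics.QuantumFieldTheory.Balaban1983to89.B6GOmega

/-!
# The Sect. 5 Theorem of B4 ("A General Theorem on Unit Lattice Operators"), kernel-proved — the leaf
`B4.Sect5ThmUniform d N` of the series DAG is a theorem

T. Bałaban, *Regularity and decay of lattice Green's functions*, Commun. Math. Phys. **89** (1983) 571–597
[Balaban1983RegularityDecay] (= B4; reference [3] of B6), read from the ×2 page renders (journal page = PDF page + 570;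
`run/shared/lean/pub/pub-balaban/b2b-balaban-ref1/pages/1983-cmp89-regularity-decay/…-p024-x2.png`, `…-p027-x2.png`).
Unit b2b-balaban-pv23-g3 (surge node prover #23, gen 3, cell pub-balaban; journal claim B4-SECT5-PROOF-KERNEL; surge
node T01.4; GAPS rows C-B4-3, G-B4-04…08, C-adv6-22…24 / G-adv6-22…26, and the certification row C-pv23g3-1).

VALUE = a kernel-checked PROOF of a published finite-dimensional theorem (the fourth conjunct of the B4 leaf
`B4.LeafB4`), hence the discharge of the hypothesis `B4.Sect5ThmUniform d N` at its tree use sites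
(`B6FromB4.engine_of_sect5Uniform`, `B6GOmega.cutFamily_uniform`, `B6Elimination.site242_uniform`,
`B6BondElimination.subReductions_uniform`, `B6WeightedEncoding.weightedSites_uniform`, …); NOT summit progress.
Nothing landed is edited: `…B4` (unit b04), `…QGQInverse` (unit r1-g3), `…B6FromB4` / `…B6GOmega` (units pv09-g2 /
b06-g2) are imported.

## The printed theorem (verbatim, p. 594 [PDF 24]) and the closing sentence of its proof (p. 597 [PDF 27])

*"Theorem. Let Ω ⊂ Z^d and let A be a symmetric operator defined on the space L²(Ω) of functions φ : Ω → R^N and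
satisfying the following condition: there exist positive constants γ₀, c₀, δ₀ such that
A ≥ γ₀I, |A(x, x′)| ≤ c₀e^{−δ₀|x−x′|}, x, x′ ∈ Ω. (5.6)
Then there exist positive constants c₁, δ₁ such that for arbitrary Λ ⊂ Ω and for C_Λ = A_Λ^{−1}, A_Λ is an operator
defined on L²(Λ) by A_Λ = ΛAΛ. We have
|C_Λ(x, x′)| ≤ c₁e^{−δ₁|x−x′|}, x, x′ ∈ Λ, (5.7)
|δC_Λ(x, x′)| ≤ c₁e^{−δ₁(|x−x′| + dist(x, Λ^c) + dist(x′, Λ^c))}, δC_Λ = C_Λ − C_Ω. (5.8)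
If we perturb the operator A by an operator B such that the condition (5.6) is satisfied for A + B, and additionally
B has the property
|B(x, x′)| ≤ c₀e^{−δ₀(|x−x′| + dist(x, Ω^c) + dist(x′, Ω^c))}, x, x′ ∈ Ω, (5.9)
then we have also
|A_Λ^{−1}(x, x′) − (A + B)_Λ^{−1}(x, x′)| ≤ c₁e^{−δ₁(|x−x′| + dist(x, Ω^c) + dist(x′, Ω^c))}, x, x′ ∈ Λ. (5.10)"*
— and, p. 597: *"Thus Inequality (5.10) is proved. The constants δ₁, c₁ are functions of δ₀, γ₀, c₀, and from the
above proof we can get more precise estimates for them."*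

The tree statement proved is `B4.Sect5ThmUniform d N` of module `…B4` — the UNIFORM reading: one pair (c₁, δ₁),
functions of (γ₀, c₀, δ₀) (and of d, N), serves every FINITE Ω ⊂ ℤ^d, every A with (5.6), every Λ ⊆ Ω, and every B
with (5.6) for A + B and (5.9); Λ^c = Ω ∖ Λ ("the complement Λ^c of Λ in Ω", p. 596), Ω^c = ℤ^d ∖ Ω, |x − x′| = the
sup-distance of `Fin d → ℤ`, entrywise kernel bounds, exactly as typed in `…B4` (D-b04.5/6) — whence the literal
reading `B4.Sect5ThmLiteral d N` (`B4.sect5_literal_of_uniform`).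

## The proof route (NOT the printed one)

The printed proof (pp. 594–597) is a "generalized random walk" expansion over M-cubes □_j ((5.11)–(5.27)), "along the
lines of the proof of Proposition I.2.1".  This file proves the SAME STATEMENT by a different, shorter route, entirely
finite-dimensional:
* (5.7) — FINITE COMBES–THOMAS: `QGQInverse.inverse_decay` (coercivity γ plus weighted absolute row/column sums
  `Σ_{x′}|A(x,x′)|(e^{κ|x−x′|} − 1) ≤ ρ < γ` ⇒ `|A⁻¹(x,x′)| ≤ (γ − ρ)⁻¹e^{−κ|x−x′|}`), fed by §1–§2 below: under (5.6) the
  weighted sums are `≤ κ·M₀`, `M₀ = c₀(4/δ₀)·N·K_d(δ₀/2)`, for every `0 ≤ κ ≤ δ₀/4`, where `K_d(a) = (2/(1 − e^{−a/d}))^d`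
  bounds the lattice sums `Σ_{y∈Ω} e^{−a|x−y|}` uniformly in the finite Ω (§1); the choice `δ₁ = min{δ₀/4, γ₀/(2M₀+1)}`
  gives (5.7) with `c₁ = 2/γ₀` for A and — since (5.6) passes to every compression A_Λ with the same constants
  (`B6GOmega.hyp56_compress`) — for every C_Λ, uniformly in Ω and Λ.
* (5.8) — the exact block (Schur-complement / resolvent) identity `δC_Λ = C_Λ·(ΛA(Ω∖Λ))·(C_Ω|_{Ω×Λ})` (`deltaC_eq`):
  the middle factor vanishes unless its column lies in Λ^c, so every term of the double sum passes through a point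
  of Λ^c and its path length dominates both `|x − x′|` and `dist(x, Λ^c) + dist(x′, Λ^c)`; the outer factors decay by
  (5.7); the two free sums are bounded by §1 (`deltaC_bound`).
* (5.10) — the second resolvent identity `A_Λ⁻¹ − (A+B)_Λ⁻¹ = A_Λ⁻¹B_Λ(A+B)_Λ⁻¹` (the paper's own (5.26), used here on Λ
  rather than on the cubes □_j; `inv_sub_inv_eq`), (5.9) for the middle factor and `dist(x, Ω^c) ≤ |x − y| +
  dist(y, Ω^c)` (`perturb_bound`).
Constants obtained (`sect5_explicit`): `δ₁* = δ₁/4`, `c₁* = max{2/γ₀, (2/γ₀)²c₀(N·K_d(δ₁/2))²}` — "functions of δ₀, γ₀,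
c₀" (and of d, N), as p. 597 says.  The symmetry of A required in (5.6) is carried by `B4.Hyp56` and not used.

## What is kernel-checked here (0 sorry; axioms propext / Classical.choice / Quot.sound only)

§1 `sum_exp_neg_abs_le`, `latticeSum_le`, `idxSum_le` (uniform lattice sums); §2 `exp_weight_le`, `weightedRowSum_le`,
`weightedColSum_le`; §3 `coercive_of_hyp56`, `isUnit_of_hyp56`, `inv_decay`, `inv_compress_decay` ((5.7), uniformly);
§4 `abs_mul3_apply_le`, `sum_sum_le_of_factor`, `exp_split`, `weaken`; §5 `sum_inclIdx`, `compress_mul_add_offBlock_mul`,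
`compress_one`, `deltaC_eq`, `deltaC_bound` ((5.8), uniformly); §6 `inv_sub_inv_eq`, `compress_add_sub`, `perturb_bound`
((5.10), uniformly); §7 `sect5_explicit`, **`sect5ThmUniform_holds : ∀ d N, B4.Sect5ThmUniform d N`**,
`sect5ThmLiteral_holds`, `leafB4_of_printed` (the B4 leaf from its three remaining PRINTED statements: Theorem
p. 573, Prop. 2.3 of I, Prop. 3.1′ of II, p. 574), and the consumer-side corollaries
`unitLatticeEngine : B6FromB4.UnitLatticeEngine d N`, `cutFamilyUniform : B6GOmega.CutFamilyUniform d N`.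

## What this does NOT do

It does not certify the printed random-walk proof (5.11)–(5.27) or its constants; it does not touch Theorem p. 573,
Prop. 2.3, Prop. 3.1′ (the first three conjuncts of `B4.LeafB4` remain verbatim-quoted published statements); it
proves no torus / infinite-Ω version of the theorem (B6 (2.152), `B6FromB4` TYPING REMARK (iii), row G-pv09g2-1):
`B4.Sect5ThmUniform` quantifies over finite Ω ⊂ ℤ^d exactly as typed in `…B4`.
-/

namespace Literature.MathematicalPhysics.QuantumFieldTheory.Balaban1983to89.B4Sect5Proof

open Finset Real Matrix

/-! ## §1  Uniform lattice sums on ℤ^d -/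

/-- A sum of powers `r ^ (φ m)` over a finite set on which `φ : ℤ → ℕ` is injective is at most the full
geometric series. [folklore] -/
theorem sum_pow_le_of_injOn (S : Finset ℤ) (φ : ℤ → ℕ) (hφ : Set.InjOn φ ↑S) {r : ℝ}
    (hr0 : 0 ≤ r) (hr1 : r < 1) : ∑ m ∈ S, r ^ φ m ≤ (1 - r)⁻¹ := by
  have h := Finset.sum_image (f := fun k : ℕ => r ^ k) (s := S) (g := φ)
    (fun x hx y hy hxy => hφ hx hy hxy)
  rw [← h, ← tsum_geometric_of_lt_one hr0 hr1]
  exact (summable_geometric_of_lt_one hr0 hr1).sum_le_tsum _ (fun k _ => pow_nonneg hr0 k)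

/-- One-dimensional lattice sum: for every finite `S ⊂ ℤ`, centre `c` and rate `b > 0`,
`Σ_{m ∈ S} e^{−b|c−m|} ≤ 2(1 − e^{−b})⁻¹`, uniformly in `S`. [folklore] -/
theorem sum_exp_neg_abs_le (S : Finset ℤ) (c : ℤ) {b : ℝ} (hb : 0 < b) :
    ∑ m ∈ S, Real.exp (-(b * |(c : ℝ) - m|)) ≤ 2 * (1 - Real.exp (-b))⁻¹ := by
  set r := Real.exp (-b) with hr
  have hr0 : 0 ≤ r := (Real.exp_pos _).le
  have hr1 : r < 1 := Real.exp_lt_one_iff.mpr (by linarith)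
  have hterm : ∀ m : ℤ, Real.exp (-(b * |(c : ℝ) - m|)) = r ^ (c - m).natAbs := by
    intro m
    have h1 : |(c : ℝ) - m| = ((c - m).natAbs : ℝ) := by
      rw [Nat.cast_natAbs, Int.cast_abs, Int.cast_sub]
    rw [h1, show -(b * ((c - m).natAbs : ℝ)) = ((c - m).natAbs : ℝ) * (-b) by ring, Real.exp_nat_mul]
  rw [← Finset.sum_filter_add_sum_filter_not S (fun m => m ≤ c)]
  have hA : ∑ m ∈ S.filter (fun m => m ≤ c), Real.exp (-(b * |(c : ℝ) - m|)) ≤ (1 - r)⁻¹ := by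
    have hinj : Set.InjOn (fun m : ℤ => (c - m).toNat) ↑(S.filter (fun m => m ≤ c)) := by
      intro x hx y hy hxy
      simp only [Finset.coe_filter, Set.mem_setOf_eq] at hx hy
      have := congrArg (fun n : ℕ => (n : ℤ)) hxy
      simp only [Int.toNat_of_nonneg (by linarith [hx.2] : (0 : ℤ) ≤ c - x),
        Int.toNat_of_nonneg (by linarith [hy.2] : (0 : ℤ) ≤ c - y)] at this
      linarith
    calc ∑ m ∈ S.filter (fun m => m ≤ c), Real.exp (-(b * |(c : ℝ) - m|))
        = ∑ m ∈ S.filter (fun m => m ≤ c), r ^ (c - m).toNat := by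
          apply Finset.sum_congr rfl
          intro m hm
          simp only [Finset.mem_filter] at hm
          rw [hterm]
          congr 1
          omega
      _ ≤ (1 - r)⁻¹ := sum_pow_le_of_injOn _ _ hinj hr0 hr1
  have hB : ∑ m ∈ S.filter (fun m => ¬ m ≤ c), Real.exp (-(b * |(c : ℝ) - m|)) ≤ (1 - r)⁻¹ := by
    have hinj : Set.InjOn (fun m : ℤ => (m - c).toNat) ↑(S.filter (fun m => ¬ m ≤ c)) := by
      intro x hx y hy hxy
      simp only [Finset.coe_filter, Set.mem_setOf_eq] at hx hy
      have := congrArg (fun n : ℕ => (n : ℤ)) hxy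
      simp only [Int.toNat_of_nonneg (by linarith [hx.2, not_le.mp hx.2] : (0 : ℤ) ≤ x - c),
        Int.toNat_of_nonneg (by linarith [not_le.mp hy.2] : (0 : ℤ) ≤ y - c)] at this
      linarith
    calc ∑ m ∈ S.filter (fun m => ¬ m ≤ c), Real.exp (-(b * |(c : ℝ) - m|))
        = ∑ m ∈ S.filter (fun m => ¬ m ≤ c), r ^ (m - c).toNat := by
          apply Finset.sum_congr rfl
          intro m hm
          simp only [Finset.mem_filter, not_le] at hm
          rw [hterm]
          congr 1
          omega
      _ ≤ (1 - r)⁻¹ := sum_pow_le_of_injOn _ _ hinj hr0 hr1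
  linarith

/-- The uniform lattice-sum constant `(2(1 − e^{−a/d})⁻¹)^d`. [folklore] -/
noncomputable def latticeConst (d : ℕ) (a : ℝ) : ℝ := (2 * (1 - Real.exp (-(a / d)))⁻¹) ^ d

/-- `K_d(a) ≥ 0` for `a ≥ 0`. [folklore] -/
theorem latticeConst_nonneg (d : ℕ) {a : ℝ} (ha : 0 ≤ a) : 0 ≤ latticeConst d a := by
  unfold latticeConst
  apply pow_nonneg
  apply mul_nonneg (by norm_num)
  apply inv_nonneg.mpr
  have : Real.exp (-(a / d)) ≤ 1 := Real.exp_le_one_iff.mpr (by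
    have : 0 ≤ a / d := div_nonneg ha (Nat.cast_nonneg d); linarith)
  linarith

/-- **Uniform lattice sums on ℤ^d** (sup metric): for every finite `Ω ⊂ ℤ^d`, every `x ∈ ℤ^d` and `a > 0`,
`Σ_{y ∈ Ω} e^{−a·dist(x,y)} ≤ (2(1 − e^{−a/d})⁻¹)^d` — the bound is independent of `Ω` and `x`.
(`dist(x,y) ≥ |x_i − y_i|` for each coordinate, so `e^{−a·dist} ≤ Π_i e^{−(a/d)|x_i−y_i|}`, and the sum of the
product over the coordinate box `Π_i {y_i : y ∈ Ω}` factorises.) [folklore] -/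
theorem latticeSum_le (d : ℕ) {a : ℝ} (ha : 0 < a) (Ω : Finset (Fin d → ℤ)) (x : Fin d → ℤ) :
    ∑ y ∈ Ω, Real.exp (-(a * dist x y)) ≤ latticeConst d a := by
  classical
  -- coordinatewise comparison
  have hcoord : ∀ y : Fin d → ℤ,
      Real.exp (-(a * dist x y)) ≤ ∏ i, Real.exp (-(a / d * |(x i : ℝ) - y i|)) := by
    intro y
    rw [← Real.exp_sum]
    apply Real.exp_le_exp.mpr
    have hsum : ∑ i : Fin d, a / d * |(x i : ℝ) - y i| ≤ a * dist x y := by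
      have h1 : ∀ i : Fin d, |(x i : ℝ) - y i| ≤ dist x y := by
        intro i
        rw [← Int.dist_eq]
        exact dist_le_pi_dist x y i
      calc ∑ i : Fin d, a / d * |(x i : ℝ) - y i| ≤ ∑ _i : Fin d, a / d * dist x y := by
            apply Finset.sum_le_sum
            intro i _
            exact mul_le_mul_of_nonneg_left (h1 i) (div_nonneg ha.le (Nat.cast_nonneg d))
        _ = (d : ℝ) * (a / d * dist x y) := by
            rw [Finset.sum_const, Finset.card_univ, Fintype.card_fin, nsmul_eq_mul]
        _ ≤ a * dist x y := by
            rcases Nat.eq_zero_or_pos d with h0 | hpos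
            · subst h0; simp; positivity
            · have : (d : ℝ) ≠ 0 := by exact_mod_cast hpos.ne'
              rw [show (d : ℝ) * (a / d * dist x y) = a * dist x y by field_simp]
    rw [Finset.sum_neg_distrib]
    linarith
  -- the coordinate box
  set t : Fin d → Finset ℤ := fun i => Ω.image (fun y => y i) with ht
  have hsub : Ω ⊆ Fintype.piFinset t := by
    intro y hy
    rw [Fintype.mem_piFinset]
    intro i
    exact Finset.mem_image_of_mem _ hy
  calc ∑ y ∈ Ω, Real.exp (-(a * dist x y))
      ≤ ∑ y ∈ Ω, ∏ i, Real.exp (-(a / d * |(x i : ℝ) - y i|)) :=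
        Finset.sum_le_sum fun y _ => hcoord y
    _ ≤ ∑ y ∈ Fintype.piFinset t, ∏ i, Real.exp (-(a / d * |(x i : ℝ) - y i|)) :=
        Finset.sum_le_sum_of_subset_of_nonneg hsub fun y _ _ =>
          Finset.prod_nonneg fun i _ => (Real.exp_pos _).le
    _ = ∏ i : Fin d, ∑ m ∈ t i, Real.exp (-(a / d * |(x i : ℝ) - m|)) :=
        (Finset.prod_univ_sum t (fun i m => Real.exp (-(a / d * |(x i : ℝ) - m|)))).symm
    _ ≤ ∏ _i : Fin d, 2 * (1 - Real.exp (-(a / d)))⁻¹ := by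
        apply Finset.prod_le_prod
        · intro i _; exact Finset.sum_nonneg fun m _ => (Real.exp_pos _).le
        · intro i _
          have hd : 0 < (d : ℝ) := by exact_mod_cast Fin.pos i
          exact sum_exp_neg_abs_le (t i) (x i) (div_pos ha hd)
    _ = latticeConst d a := by
        rw [Finset.prod_const, Finset.card_univ, Fintype.card_fin]; rfl


/-! ## §2  Smallness of the `(e^{κ·dist} − 1)`-weighted kernel sums for small `κ` -/

/-- Elementary: for `0 ≤ κ ≤ δ₀/4` and `n ≥ 0`, `e^{−δ₀n}(e^{κn} − 1) ≤ κ(4/δ₀)e^{−δ₀n/2}`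
(`e^{κn} − 1 ≤ κne^{κn}` and `n ≤ (4/δ₀)e^{δ₀n/4}`). [folklore] -/
theorem exp_weight_le {δ₀ κ n : ℝ} (hδ : 0 < δ₀) (hκ0 : 0 ≤ κ) (hκ : κ ≤ δ₀ / 4) (hn : 0 ≤ n) :
    Real.exp (-(δ₀ * n)) * (Real.exp (κ * n) - 1) ≤ κ * (4 / δ₀) * Real.exp (-(δ₀ / 2 * n)) := by
  have h1 : Real.exp (κ * n) - 1 ≤ κ * n * Real.exp (κ * n) := by
    have ha := Real.add_one_le_exp (-(κ * n))
    have hpos := Real.exp_pos (κ * n)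
    have h2 : Real.exp (κ * n) * (1 - κ * n) ≤ 1 := by
      calc Real.exp (κ * n) * (1 - κ * n) ≤ Real.exp (κ * n) * Real.exp (-(κ * n)) := by
            apply mul_le_mul_of_nonneg_left _ hpos.le; linarith
        _ = 1 := by rw [← Real.exp_add]; simp
    nlinarith
  have h2 : n ≤ 4 / δ₀ * Real.exp (δ₀ / 4 * n) := by
    have ha := Real.add_one_le_exp (δ₀ / 4 * n)
    have h4 : δ₀ / 4 * n ≤ Real.exp (δ₀ / 4 * n) := by linarith
    calc n = 4 / δ₀ * (δ₀ / 4 * n) := by field_simp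
      _ ≤ 4 / δ₀ * Real.exp (δ₀ / 4 * n) :=
          mul_le_mul_of_nonneg_left h4 (div_nonneg (by norm_num) hδ.le)
  have e1 : Real.exp (-(δ₀ * n)) * (κ * n * Real.exp (κ * n)) =
      κ * n * Real.exp ((κ - δ₀) * n) := by
    rw [show (κ - δ₀) * n = κ * n + -(δ₀ * n) by ring, Real.exp_add]; ring
  have e2 : κ * (4 / δ₀ * Real.exp (δ₀ / 4 * n)) * Real.exp ((κ - δ₀) * n) =
      κ * (4 / δ₀) * Real.exp ((κ - 3 * δ₀ / 4) * n) := by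
    rw [show (κ - 3 * δ₀ / 4) * n = δ₀ / 4 * n + (κ - δ₀) * n by ring, Real.exp_add]; ring
  calc Real.exp (-(δ₀ * n)) * (Real.exp (κ * n) - 1)
      ≤ Real.exp (-(δ₀ * n)) * (κ * n * Real.exp (κ * n)) :=
        mul_le_mul_of_nonneg_left h1 (Real.exp_pos _).le
    _ = κ * n * Real.exp ((κ - δ₀) * n) := e1
    _ ≤ κ * (4 / δ₀ * Real.exp (δ₀ / 4 * n)) * Real.exp ((κ - δ₀) * n) := by
        apply mul_le_mul_of_nonneg_right _ (Real.exp_pos _).le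
        exact mul_le_mul_of_nonneg_left h2 hκ0
    _ = κ * (4 / δ₀) * Real.exp ((κ - 3 * δ₀ / 4) * n) := e2
    _ ≤ κ * (4 / δ₀) * Real.exp (-(δ₀ / 2 * n)) := by
        apply mul_le_mul_of_nonneg_left _ (mul_nonneg hκ0 (div_nonneg (by norm_num) hδ.le))
        apply Real.exp_le_exp.mpr
        nlinarith

/-- The lattice sum over the index set `Ω × Fin N` of [3] Sect. 5 (`B4.Idx Ω N`): `N` copies of the ℤ^d sum.
[folklore] -/
theorem idxSum_le {d N : ℕ} {a : ℝ} (ha : 0 < a) (Ω : Finset (Fin d → ℤ)) (x : Fin d → ℤ) :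
    ∑ q : B4.Idx Ω N, Real.exp (-(a * dist x (q.1 : Fin d → ℤ))) ≤ N * latticeConst d a := by
  rw [Fintype.sum_prod_type]
  simp only [Finset.sum_const, Finset.card_univ, Fintype.card_fin, nsmul_eq_mul]
  rw [← Finset.mul_sum]
  apply mul_le_mul_of_nonneg_left _ (Nat.cast_nonneg N)
  rw [Finset.sum_coe_sort Ω (fun y : Fin d → ℤ => Real.exp (-(a * dist x y)))]
  exact latticeSum_le d ha Ω x

/-- The smallness constant `M₀ = c₀(4/δ₀)·N·K_d(δ₀/2)` of the weighted sums. [folklore] -/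
noncomputable def weightConst (d N : ℕ) (c₀ δ₀ : ℝ) : ℝ := c₀ * (4 / δ₀) * (N * latticeConst d (δ₀ / 2))

/-- `M₀ ≥ 0`. [folklore] -/
theorem weightConst_nonneg (d N : ℕ) {c₀ δ₀ : ℝ} (hc : 0 ≤ c₀) (hδ : 0 < δ₀) :
    0 ≤ weightConst d N c₀ δ₀ := by
  unfold weightConst
  have := latticeConst_nonneg d (half_pos hδ).le
  positivity

/-- Weighted ROW sums: under the kernel bound of (5.6), for `0 ≤ κ ≤ δ₀/4`,
`Σ_q |A(p,q)|(e^{κ·dist(p,q)} − 1) ≤ κ·M₀` uniformly in `Ω` and `p`. [folklore] -/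
theorem weightedRowSum_le {d N : ℕ} {Ω : Finset (Fin d → ℤ)} (A : Matrix (B4.Idx Ω N) (B4.Idx Ω N) ℝ)
    {c₀ δ₀ κ : ℝ} (hc : 0 ≤ c₀) (hδ : 0 < δ₀) (hκ0 : 0 ≤ κ) (hκ : κ ≤ δ₀ / 4)
    (hA : ∀ p q : B4.Idx Ω N,
      |A p q| ≤ c₀ * Real.exp (-(δ₀ * dist (p.1 : Fin d → ℤ) (q.1 : Fin d → ℤ))))
    (p : B4.Idx Ω N) :
    ∑ q, |A p q| * (Real.exp (κ * dist (p.1 : Fin d → ℤ) (q.1 : Fin d → ℤ)) - 1) ≤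
      κ * weightConst d N c₀ δ₀ := by
  have step : ∀ q : B4.Idx Ω N,
      |A p q| * (Real.exp (κ * dist (p.1 : Fin d → ℤ) (q.1 : Fin d → ℤ)) - 1) ≤
        c₀ * (κ * (4 / δ₀)) * Real.exp (-(δ₀ / 2 * dist (p.1 : Fin d → ℤ) (q.1 : Fin d → ℤ))) := by
    intro q
    set n := dist (p.1 : Fin d → ℤ) (q.1 : Fin d → ℤ) with hn
    have hn0 : 0 ≤ n := dist_nonneg
    have hw : 0 ≤ Real.exp (κ * n) - 1 := by
      have : (1 : ℝ) ≤ Real.exp (κ * n) := Real.one_le_exp (mul_nonneg hκ0 hn0)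
      linarith
    calc |A p q| * (Real.exp (κ * n) - 1) ≤ c₀ * Real.exp (-(δ₀ * n)) * (Real.exp (κ * n) - 1) :=
          mul_le_mul_of_nonneg_right (hA p q) hw
      _ = c₀ * (Real.exp (-(δ₀ * n)) * (Real.exp (κ * n) - 1)) := by ring
      _ ≤ c₀ * (κ * (4 / δ₀) * Real.exp (-(δ₀ / 2 * n))) :=
          mul_le_mul_of_nonneg_left (exp_weight_le hδ hκ0 hκ hn0) hc
      _ = c₀ * (κ * (4 / δ₀)) * Real.exp (-(δ₀ / 2 * n)) := by ring
  calc ∑ q, |A p q| * (Real.exp (κ * dist (p.1 : Fin d → ℤ) (q.1 : Fin d → ℤ)) - 1)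
      ≤ ∑ q : B4.Idx Ω N, c₀ * (κ * (4 / δ₀)) *
          Real.exp (-(δ₀ / 2 * dist (p.1 : Fin d → ℤ) (q.1 : Fin d → ℤ))) :=
        Finset.sum_le_sum fun q _ => step q
    _ = c₀ * (κ * (4 / δ₀)) *
          ∑ q : B4.Idx Ω N, Real.exp (-(δ₀ / 2 * dist (p.1 : Fin d → ℤ) (q.1 : Fin d → ℤ))) := by
        rw [Finset.mul_sum]
    _ ≤ c₀ * (κ * (4 / δ₀)) * (N * latticeConst d (δ₀ / 2)) := by
        apply mul_le_mul_of_nonneg_left (idxSum_le (half_pos hδ) Ω _)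
        exact mul_nonneg hc (mul_nonneg hκ0 (div_nonneg (by norm_num) hδ.le))
    _ = κ * weightConst d N c₀ δ₀ := by unfold weightConst; ring

/-- Weighted COLUMN sums, by the symmetry of the distance. [folklore] -/
theorem weightedColSum_le {d N : ℕ} {Ω : Finset (Fin d → ℤ)} (A : Matrix (B4.Idx Ω N) (B4.Idx Ω N) ℝ)
    {c₀ δ₀ κ : ℝ} (hc : 0 ≤ c₀) (hδ : 0 < δ₀) (hκ0 : 0 ≤ κ) (hκ : κ ≤ δ₀ / 4)
    (hA : ∀ p q : B4.Idx Ω N,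
      |A p q| ≤ c₀ * Real.exp (-(δ₀ * dist (p.1 : Fin d → ℤ) (q.1 : Fin d → ℤ))))
    (q : B4.Idx Ω N) :
    ∑ p, |A p q| * (Real.exp (κ * dist (p.1 : Fin d → ℤ) (q.1 : Fin d → ℤ)) - 1) ≤
      κ * weightConst d N c₀ δ₀ := by
  have hAt : ∀ p q : B4.Idx Ω N,
      |A.transpose p q| ≤ c₀ * Real.exp (-(δ₀ * dist (p.1 : Fin d → ℤ) (q.1 : Fin d → ℤ))) := by
    intro p q
    rw [Matrix.transpose_apply, dist_comm]
    exact hA q p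
  have h := weightedRowSum_le A.transpose hc hδ hκ0 hκ hAt q
  simp only [Matrix.transpose_apply] at h
  calc ∑ p, |A p q| * (Real.exp (κ * dist (p.1 : Fin d → ℤ) (q.1 : Fin d → ℤ)) - 1)
      = ∑ p, |A p q| * (Real.exp (κ * dist (q.1 : Fin d → ℤ) (p.1 : Fin d → ℤ)) - 1) := by
        apply Finset.sum_congr rfl; intro p _; rw [dist_comm]
    _ ≤ κ * weightConst d N c₀ δ₀ := h

/-! ## §3  (5.7): decay of the inverse kernel, uniformly in Ω (finite Combes–Thomas, `QGQInverse.inverse_decay`) -/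

/-- The (5.7)-rate `δ₁ = min{δ₀/4, γ₀/(2M₀ + 1)}` (so that `δ₁M₀ ≤ γ₀/2`). [folklore] -/
noncomputable def delta1 (d N : ℕ) (γ₀ c₀ δ₀ : ℝ) : ℝ :=
  min (δ₀ / 4) (γ₀ / (2 * weightConst d N c₀ δ₀ + 1))

/-- `δ₁ > 0`. [folklore] -/
theorem delta1_pos (d N : ℕ) {γ₀ c₀ δ₀ : ℝ} (hγ : 0 < γ₀) (hc : 0 ≤ c₀) (hδ : 0 < δ₀) :
    0 < delta1 d N γ₀ c₀ δ₀ := by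
  unfold delta1
  have := weightConst_nonneg d N hc hδ
  apply lt_min (by linarith)
  positivity

/-- `δ₁ ≤ δ₀/4`. [folklore] -/
theorem delta1_le_quarter (d N : ℕ) (γ₀ c₀ : ℝ) {δ₀ : ℝ} :
    delta1 d N γ₀ c₀ δ₀ ≤ δ₀ / 4 := min_le_left _ _

/-- `δ₁ ≤ δ₀`. [folklore] -/
theorem delta1_le_delta0 (d N : ℕ) (γ₀ c₀ : ℝ) {δ₀ : ℝ} (hδ : 0 < δ₀) :
    delta1 d N γ₀ c₀ δ₀ ≤ δ₀ := (min_le_left _ _).trans (by linarith)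

/-- `δ₁·M₀ ≤ γ₀/2`. [folklore] -/
theorem delta1_mul_weightConst_le (d N : ℕ) {γ₀ c₀ δ₀ : ℝ} (hγ : 0 < γ₀) (hc : 0 ≤ c₀) (hδ : 0 < δ₀) :
    delta1 d N γ₀ c₀ δ₀ * weightConst d N c₀ δ₀ ≤ γ₀ / 2 := by
  set M := weightConst d N c₀ δ₀ with hM
  have hM0 : 0 ≤ M := weightConst_nonneg d N hc hδ
  have h1 : delta1 d N γ₀ c₀ δ₀ ≤ γ₀ / (2 * M + 1) := min_le_right _ _
  calc delta1 d N γ₀ c₀ δ₀ * M ≤ γ₀ / (2 * M + 1) * M := mul_le_mul_of_nonneg_right h1 hM0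
    _ ≤ γ₀ / 2 := by
        rw [div_mul_eq_mul_div, div_le_div_iff₀ (by positivity) (by norm_num)]
        nlinarith

/-- `Hyp56`'s quadratic-form conjunct is `QGQInverse.Coercive`. [folklore] -/
theorem coercive_of_hyp56 {d N : ℕ} {Ω : Finset (Fin d → ℤ)} {A : Matrix (B4.Idx Ω N) (B4.Idx Ω N) ℝ}
    {γ₀ c₀ δ₀ : ℝ} (hA : B4.Hyp56 Ω A γ₀ c₀ δ₀) : QGQInverse.Coercive A γ₀ := by
  intro x
  have h := hA.2.1 x
  have e1 : x ⬝ᵥ x = ∑ p, x p ^ 2 := by simp [dotProduct, pow_two]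
  have e2 : x ⬝ᵥ (A *ᵥ x) = ∑ p, x p * A.mulVec x p := rfl
  rw [e1, e2]; exact h

/-- A matrix with (5.6) is a unit (coercivity). [folklore] -/
theorem isUnit_of_hyp56 {d N : ℕ} {Ω : Finset (Fin d → ℤ)} {A : Matrix (B4.Idx Ω N) (B4.Idx Ω N) ℝ}
    {γ₀ c₀ δ₀ : ℝ} (hγ : 0 < γ₀) (hA : B4.Hyp56 Ω A γ₀ c₀ δ₀) : IsUnit A :=
  QGQInverse.isUnit_of_coercive hγ (coercive_of_hyp56 hA)

/-- **(5.7) for `A` itself, uniformly in Ω**: under (5.6) with constants `(γ₀, c₀, δ₀)`,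
`|A⁻¹(x,x′)| ≤ (2/γ₀)e^{−δ₁|x−x′|}` with `δ₁ = delta1 d N γ₀ c₀ δ₀` — for EVERY finite `Ω ⊂ ℤ^d`.
Finite Combes–Thomas: `QGQInverse.inverse_decay` with the weighted sums of §2 (`ρ = δ₁M₀ ≤ γ₀/2`). [folklore] -/
theorem inv_decay {d N : ℕ} {γ₀ c₀ δ₀ : ℝ} (hγ : 0 < γ₀) (hc : 0 ≤ c₀) (hδ : 0 < δ₀)
    {Ω : Finset (Fin d → ℤ)} {A : Matrix (B4.Idx Ω N) (B4.Idx Ω N) ℝ} (hA : B4.Hyp56 Ω A γ₀ c₀ δ₀)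
    (p q : B4.Idx Ω N) :
    |A⁻¹ p q| ≤ 2 / γ₀ * Real.exp (-(delta1 d N γ₀ c₀ δ₀ * dist (p.1 : Fin d → ℤ) (q.1 : Fin d → ℤ))) := by
  set δ₁ := delta1 d N γ₀ c₀ δ₀ with hδ₁
  set ρ := δ₁ * weightConst d N c₀ δ₀ with hρ
  have hδ₁0 : 0 ≤ δ₁ := (delta1_pos d N hγ hc hδ).le
  have hδ₁4 : δ₁ ≤ δ₀ / 4 := delta1_le_quarter d N γ₀ c₀
  have hρle : ρ ≤ γ₀ / 2 := delta1_mul_weightConst_le d N hγ hc hδ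
  have hργ : ρ < γ₀ := by linarith
  have h := QGQInverse.inverse_decay A (fun p q : B4.Idx Ω N => dist (p.1 : Fin d → ℤ) (q.1 : Fin d → ℤ))
    hργ hδ₁0 (coercive_of_hyp56 hA) (fun i j => dist_comm _ _) (fun i => dist_self _)
    (fun i j k => dist_triangle _ _ _)
    (fun i => weightedRowSum_le A hc hδ hδ₁0 hδ₁4 hA.2.2 i)
    (fun j => weightedColSum_le A hc hδ hδ₁0 hδ₁4 hA.2.2 j) p q
  refine h.trans ?_
  apply mul_le_mul_of_nonneg_right _ (Real.exp_pos _).le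
  rw [div_eq_mul_inv, show (2 : ℝ) * γ₀⁻¹ = (γ₀ / 2)⁻¹ by rw [inv_div]; ring]
  exact inv_anti₀ (by linarith) (by linarith)

/-- **(5.7) for every compression `A_Λ`, Λ ⊆ Ω, with the SAME constants** ((5.6) passes to compressions:
`B6GOmega.hyp56_compress`). [folklore] -/
theorem inv_compress_decay {d N : ℕ} {γ₀ c₀ δ₀ : ℝ} (hγ : 0 < γ₀) (hc : 0 ≤ c₀) (hδ : 0 < δ₀)
    {Ω : Finset (Fin d → ℤ)} {A : Matrix (B4.Idx Ω N) (B4.Idx Ω N) ℝ} (hA : B4.Hyp56 Ω A γ₀ c₀ δ₀)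
    {Λ : Finset (Fin d → ℤ)} (h : Λ ⊆ Ω) (p q : B4.Idx Λ N) :
    |(B4.compress h A)⁻¹ p q| ≤
      2 / γ₀ * Real.exp (-(delta1 d N γ₀ c₀ δ₀ * dist (p.1 : Fin d → ℤ) (q.1 : Fin d → ℤ))) :=
  inv_decay hγ hc hδ (B6GOmega.hyp56_compress h hγ.le hc hδ.le hA) p q


/-! ## §4  Triple products of decaying kernels -/

section Triple

variable {α β γ ε : Type*} [Fintype β] [Fintype γ]

/-- `|(XMY)(i,k)| ≤ Σ_r Σ_s |X(i,r)||M(r,s)||Y(s,k)|`. [folklore] -/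
theorem abs_mul3_apply_le (X : Matrix α β ℝ) (M : Matrix β γ ℝ) (Y : Matrix γ ε ℝ) (i : α) (k : ε) :
    |(X * M * Y) i k| ≤ ∑ r, ∑ s, |X i r| * |M r s| * |Y s k| := by
  have e : (X * M * Y) i k = ∑ s, ∑ r, X i r * M r s * Y s k := by
    simp only [Matrix.mul_apply, Finset.sum_mul]
  rw [e, Finset.sum_comm]
  refine (Finset.abs_sum_le_sum_abs _ _).trans (Finset.sum_le_sum fun r _ => ?_)
  refine (Finset.abs_sum_le_sum_abs _ _).trans (le_of_eq (Finset.sum_congr rfl fun s _ => ?_))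
  rw [abs_mul, abs_mul]

/-- Summation of a factorised majorant: `t(r,s) ≤ W·a(r)·b(s)`, `Σa ≤ K_a`, `Σb ≤ K_b` ⇒ `Σ_rΣ_s t ≤ W·K_a·K_b`.
[folklore] -/
theorem sum_sum_le_of_factor (t : β → γ → ℝ) (a : β → ℝ) (b : γ → ℝ) {W Ka Kb : ℝ}
    (hW : 0 ≤ W) (ha : ∀ r, 0 ≤ a r) (hb : ∀ s, 0 ≤ b s) (ht : ∀ r s, t r s ≤ W * a r * b s)
    (hKa : ∑ r, a r ≤ Ka) (hKb : ∑ s, b s ≤ Kb) :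
    ∑ r, ∑ s, t r s ≤ W * Ka * Kb := by
  have hA0 : 0 ≤ ∑ r, a r := Finset.sum_nonneg fun r _ => ha r
  have hB0 : 0 ≤ ∑ s, b s := Finset.sum_nonneg fun s _ => hb s
  calc ∑ r, ∑ s, t r s ≤ ∑ r, ∑ s, W * a r * b s :=
        Finset.sum_le_sum fun r _ => Finset.sum_le_sum fun s _ => ht r s
    _ = ∑ r, W * a r * ∑ s, b s :=
        Finset.sum_congr rfl fun r _ => by rw [Finset.mul_sum]
    _ = W * (∑ r, a r) * ∑ s, b s := by rw [← Finset.sum_mul, ← Finset.mul_sum]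
    _ ≤ W * Ka * Kb := by
        apply mul_le_mul _ hKb hB0 (mul_nonneg hW (hA0.trans hKa))
        exact mul_le_mul_of_nonneg_left hKa hW

/-- The exponent bookkeeping common to (5.8) and (5.10): a chain `x → r → s → x′` of total weighted length
`δ₁D₁ + δ₀D₂ + δ₁D₃` (`δ₁ ≤ δ₀`) with `T ≤ 2(D₁ + D₂ + D₃)` leaves, after reserving `e^{−(δ₁/4)T}`, the
summable factors `e^{−(δ₁/2)D₁}`, `e^{−(δ₁/2)D₃}`. [folklore] -/
theorem exp_split {δ₁ δ₀ D₁ D₂ D₃ T : ℝ} (hδ₁ : 0 ≤ δ₁) (h10 : δ₁ ≤ δ₀) (hD₂ : 0 ≤ D₂)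
    (hT : T ≤ 2 * (D₁ + D₂ + D₃)) :
    Real.exp (-(δ₁ * D₁)) * Real.exp (-(δ₀ * D₂)) * Real.exp (-(δ₁ * D₃)) ≤
      Real.exp (-(δ₁ / 4 * T)) * Real.exp (-(δ₁ / 2 * D₁)) * Real.exp (-(δ₁ / 2 * D₃)) := by
  rw [← Real.exp_add, ← Real.exp_add, ← Real.exp_add, ← Real.exp_add]
  apply Real.exp_le_exp.mpr
  have h1 := mul_le_mul_of_nonneg_right h10 hD₂
  have h2 := mul_le_mul_of_nonneg_left hT (by linarith : 0 ≤ δ₁ / 4)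
  nlinarith [mul_nonneg hδ₁ hD₂]

/-- Weakening a kernel bound: larger constant, smaller rate. [folklore] -/
theorem weaken {c c' δ δ' t : ℝ} (hc0 : 0 ≤ c) (hc : c ≤ c') (hδ : δ' ≤ δ) (ht : 0 ≤ t) :
    c * Real.exp (-(δ * t)) ≤ c' * Real.exp (-(δ' * t)) := by
  apply mul_le_mul hc _ (Real.exp_pos _).le (hc0.trans hc)
  exact Real.exp_le_exp.mpr (by nlinarith)

end Triple

/-! ## §5  (5.8): the block identity `δC_Λ = C_Λ − (C_Ω)|_Λ = C_Λ · (ΛA(Ω∖Λ)) · C_Ω|_{(Ω∖Λ)×Λ}` and its decay -/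

section Blocks

variable {d N : ℕ}

/-- Sums over the image of the index inclusion `Λ ⊆ Ω` are sums over Ω restricted to positions in Λ. [folklore] -/
theorem sum_inclIdx {Ω Λ : Finset (Fin d → ℤ)} (h : Λ ⊆ Ω) (f : B4.Idx Ω N → ℝ) :
    ∑ k : B4.Idx Λ N, f (B4.inclIdx h k) =
      ∑ s : B4.Idx Ω N, if (s.1 : Fin d → ℤ) ∈ Λ then f s else 0 := by
  classical
  let e : B4.Idx Λ N ↪ B4.Idx Ω N := ⟨B4.inclIdx h, B6GOmega.inclIdx_injective h⟩
  have h1 : ∑ k : B4.Idx Λ N, f (B4.inclIdx h k) = ∑ s ∈ (Finset.univ.map e), f s := by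
    rw [Finset.sum_map]; rfl
  have h2 : (Finset.univ.map e) =
      Finset.univ.filter (fun s : B4.Idx Ω N => (s.1 : Fin d → ℤ) ∈ Λ) := by
    ext s
    simp only [Finset.mem_map, Finset.mem_univ, true_and, Finset.mem_filter]
    constructor
    · rintro ⟨k, rfl⟩; exact k.1.2
    · intro hs
      exact ⟨(⟨(s.1 : Fin d → ℤ), hs⟩, s.2), rfl⟩
  rw [h1, h2, Finset.sum_filter]

/-- The off-block `Λ A (Ω∖Λ)` of a kernel on Ω: rows indexed by Λ, columns by Ω, zero on the columns with
position in Λ — the operator through which `C_Λ` and `C_Ω` communicate in the resolvent identity behind (5.8).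
[cite: Balaban1983RegularityDecay, (5.8) p.594] -/
def offBlock {Ω Λ : Finset (Fin d → ℤ)} (h : Λ ⊆ Ω) (A : Matrix (B4.Idx Ω N) (B4.Idx Ω N) ℝ) :
    Matrix (B4.Idx Λ N) (B4.Idx Ω N) ℝ :=
  Matrix.of fun r s => if (s.1 : Fin d → ℤ) ∈ Λ then 0 else A (B4.inclIdx h r) s

/-- The Ω × Λ block `Cι` of a kernel `C` on Ω (columns restricted to Λ). [folklore] -/
def colBlock {Ω Λ : Finset (Fin d → ℤ)} (h : Λ ⊆ Ω) (C : Matrix (B4.Idx Ω N) (B4.Idx Ω N) ℝ) :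
    Matrix (B4.Idx Ω N) (B4.Idx Λ N) ℝ :=
  Matrix.of fun s q => C s (B4.inclIdx h q)

/-- Entry formula of the off-block. [folklore] -/
@[simp] theorem offBlock_apply {Ω Λ : Finset (Fin d → ℤ)} (h : Λ ⊆ Ω)
    (A : Matrix (B4.Idx Ω N) (B4.Idx Ω N) ℝ) (r : B4.Idx Λ N) (s : B4.Idx Ω N) :
    offBlock h A r s = if (s.1 : Fin d → ℤ) ∈ Λ then 0 else A (B4.inclIdx h r) s := rfl

/-- Entry formula of the column block. [folklore] -/
@[simp] theorem colBlock_apply {Ω Λ : Finset (Fin d → ℤ)} (h : Λ ⊆ Ω)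
    (C : Matrix (B4.Idx Ω N) (B4.Idx Ω N) ℝ) (s : B4.Idx Ω N) (q : B4.Idx Λ N) :
    colBlock h C s q = C s (B4.inclIdx h q) := rfl

/-- Splitting `Σ_{s∈Ω} A(r,s)C(s,q)` into positions in Λ and in Ω∖Λ: `A_Λ·C|_Λ + (ΛA(Ω∖Λ))·(Cι) = (AC)|_Λ`.
[folklore] -/
theorem compress_mul_add_offBlock_mul {Ω Λ : Finset (Fin d → ℤ)} (h : Λ ⊆ Ω)
    (A C : Matrix (B4.Idx Ω N) (B4.Idx Ω N) ℝ) :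
    B4.compress h A * B4.compress h C + offBlock h A * colBlock h C = B4.compress h (A * C) := by
  ext r q
  simp only [Matrix.add_apply, Matrix.mul_apply, B4.compress, Matrix.submatrix_apply, offBlock_apply,
    colBlock_apply]
  rw [sum_inclIdx h (fun s => A (B4.inclIdx h r) s * C s (B4.inclIdx h q)), ← Finset.sum_add_distrib]
  apply Finset.sum_congr rfl
  intro s _
  split_ifs <;> simp

/-- `1|_Λ = 1`. [folklore] -/
theorem compress_one {Ω Λ : Finset (Fin d → ℤ)} (h : Λ ⊆ Ω) :
    B4.compress (N := N) h (1 : Matrix (B4.Idx Ω N) (B4.Idx Ω N) ℝ) = 1 := by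
  ext r q
  simp only [B4.compress, Matrix.submatrix_apply, Matrix.one_apply,
    (B6GOmega.inclIdx_injective h).eq_iff]

/-- **The resolvent (Schur-block) identity behind (5.8)** (p. 594; the paper's route to (5.8) is the random-walk
expansion (5.24)–(5.27), here replaced by exact block algebra): for invertible `A` on L²(Ω) with invertible
compression `A_Λ`, `δC_Λ := C_Λ − C_Ω|_Λ = C_Λ · (ΛA(Ω∖Λ)) · (C_Ω ι)`. [cite: Balaban1983RegularityDecay, (5.8) p.594] -/
theorem deltaC_eq {Ω Λ : Finset (Fin d → ℤ)} (h : Λ ⊆ Ω) {A : Matrix (B4.Idx Ω N) (B4.Idx Ω N) ℝ}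
    (hA : IsUnit A) (hAΛ : IsUnit (B4.compress h A)) :
    (B4.compress h A)⁻¹ - B4.compress h A⁻¹ =
      (B4.compress h A)⁻¹ * offBlock h A * colBlock h A⁻¹ := by
  have hdet : IsUnit A.det := (Matrix.isUnit_iff_isUnit_det A).mp hA
  have hdetΛ : IsUnit (B4.compress h A).det := (Matrix.isUnit_iff_isUnit_det _).mp hAΛ
  have key := compress_mul_add_offBlock_mul h A A⁻¹
  rw [Matrix.mul_nonsing_inv A hdet, compress_one] at key
  have k2 := congrArg (fun X => (B4.compress h A)⁻¹ * X) key
  simp only [Matrix.mul_add, ← Matrix.mul_assoc, Matrix.nonsing_inv_mul _ hdetΛ, Matrix.one_mul,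
    Matrix.mul_one] at k2
  exact sub_eq_of_eq_add' k2.symm

/-- The constant of (5.8)/(5.10): `c₁c₀c₁(N·K_d(δ₁/2))²`, `c₁ = 2/γ₀`. [folklore] -/
noncomputable def bigConst (d N : ℕ) (γ₀ c₀ δ₀ : ℝ) : ℝ :=
  2 / γ₀ * c₀ * (2 / γ₀) * (N * latticeConst d (delta1 d N γ₀ c₀ δ₀ / 2)) *
    (N * latticeConst d (delta1 d N γ₀ c₀ δ₀ / 2))

/-- The (5.8)/(5.10) constant is nonnegative. [folklore] -/
theorem bigConst_nonneg (d N : ℕ) {γ₀ c₀ δ₀ : ℝ} (hγ : 0 < γ₀) (hc : 0 ≤ c₀) (hδ : 0 < δ₀) :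
    0 ≤ bigConst d N γ₀ c₀ δ₀ := by
  unfold bigConst
  have := latticeConst_nonneg d (half_pos (delta1_pos d N hγ hc hδ)).le
  positivity

/-- **(5.8), uniformly in Ω and Λ**: under (5.6),
`|C_Λ(x,x′) − C_Ω(x,x′)| ≤ c·e^{−(δ₁/4)(|x−x′| + dist(x,Λᶜ) + dist(x′,Λᶜ))}`, Λᶜ = Ω∖Λ, with
`c = bigConst`, `δ₁ = delta1`.  Mechanism: `deltaC_eq`; the middle factor lives on columns in Ω∖Λ, so every term
of the double sum passes through a point of Λᶜ (path length ≥ dist(x,Λᶜ) + dist(x′,Λᶜ) and ≥ |x−x′|); the two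
outer factors decay by (5.7) (`inv_compress_decay`, `inv_decay`) and are summed with §1. [cite: Balaban1983RegularityDecay, (5.8) p.594] -/
theorem deltaC_bound {γ₀ c₀ δ₀ : ℝ} (hγ : 0 < γ₀) (hc : 0 < c₀) (hδ : 0 < δ₀)
    {Ω : Finset (Fin d → ℤ)} {A : Matrix (B4.Idx Ω N) (B4.Idx Ω N) ℝ} (hA : B4.Hyp56 Ω A γ₀ c₀ δ₀)
    {Λ : Finset (Fin d → ℤ)} (h : Λ ⊆ Ω) (p q : B4.Idx Λ N) :
    |(B4.compress h A)⁻¹ p q - A⁻¹ (B4.inclIdx h p) (B4.inclIdx h q)| ≤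
      bigConst d N γ₀ c₀ δ₀ * Real.exp (-(delta1 d N γ₀ c₀ δ₀ / 4 *
        (dist (p.1 : Fin d → ℤ) (q.1 : Fin d → ℤ)
          + Metric.infDist (p.1 : Fin d → ℤ) (((Ω \ Λ : Finset (Fin d → ℤ))) : Set (Fin d → ℤ))
          + Metric.infDist (q.1 : Fin d → ℤ) (((Ω \ Λ : Finset (Fin d → ℤ))) : Set (Fin d → ℤ))))) := by
  set δ₁ := delta1 d N γ₀ c₀ δ₀ with hδ₁
  set c₁ : ℝ := 2 / γ₀ with hc₁
  set K₁ : ℝ := N * latticeConst d (δ₁ / 2) with hK₁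
  set Lc : Set (Fin d → ℤ) := (((Ω \ Λ : Finset (Fin d → ℤ))) : Set (Fin d → ℤ)) with hLc
  set T := dist (p.1 : Fin d → ℤ) (q.1 : Fin d → ℤ) + Metric.infDist (p.1 : Fin d → ℤ) Lc
    + Metric.infDist (q.1 : Fin d → ℤ) Lc with hT
  have hδ₁pos : 0 < δ₁ := delta1_pos d N hγ hc.le hδ
  have hδ₁0 : 0 ≤ δ₁ := hδ₁pos.le
  have hδ₁δ₀ : δ₁ ≤ δ₀ := delta1_le_delta0 d N γ₀ c₀ hδ
  have hc₁0 : 0 ≤ c₁ := by rw [hc₁]; positivity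
  have hAΛ : B4.Hyp56 Λ (B4.compress h A) γ₀ c₀ δ₀ := B6GOmega.hyp56_compress h hγ.le hc.le hδ.le hA
  -- the entry is a triple product
  have entry : (B4.compress h A)⁻¹ p q - A⁻¹ (B4.inclIdx h p) (B4.inclIdx h q) =
      ((B4.compress h A)⁻¹ * offBlock h A * colBlock h A⁻¹) p q := by
    have e := deltaC_eq h (isUnit_of_hyp56 hγ hA) (isUnit_of_hyp56 hγ hAΛ)
    have e' := congrFun (congrFun e p) q
    rw [Matrix.sub_apply] at e'
    exact e'
  rw [entry]
  refine (abs_mul3_apply_le _ _ _ p q).trans ?_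
  set W := c₁ * c₀ * c₁ * Real.exp (-(δ₁ / 4 * T)) with hW
  have hW0 : 0 ≤ W := by rw [hW]; positivity
  have main := sum_sum_le_of_factor
    (fun (r : B4.Idx Λ N) (s : B4.Idx Ω N) =>
      |(B4.compress h A)⁻¹ p r| * |offBlock h A r s| * |colBlock h A⁻¹ s q|)
    (fun r : B4.Idx Λ N => Real.exp (-(δ₁ / 2 * dist (p.1 : Fin d → ℤ) (r.1 : Fin d → ℤ))))
    (fun s : B4.Idx Ω N => Real.exp (-(δ₁ / 2 * dist (q.1 : Fin d → ℤ) (s.1 : Fin d → ℤ))))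
    (W := W) (Ka := K₁) (Kb := K₁) hW0 (fun r => (Real.exp_pos _).le) (fun s => (Real.exp_pos _).le)
    ?_ (idxSum_le (half_pos hδ₁pos) Λ _) (idxSum_le (half_pos hδ₁pos) Ω _)
  · refine main.trans (le_of_eq ?_)
    rw [hW]; unfold bigConst; rw [← hδ₁, ← hK₁]; ring
  -- pointwise factorised majorant
  intro r s
  by_cases hs : (s.1 : Fin d → ℤ) ∈ Λ
  · have : offBlock h A r s = 0 := by simp [hs]
    rw [this, abs_zero, mul_zero, zero_mul]
    positivity
  · -- the three kernel bounds
    have hX := inv_compress_decay hγ hc.le hδ hA h p r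
    have hM : |offBlock h A r s| ≤
        c₀ * Real.exp (-(δ₀ * dist (r.1 : Fin d → ℤ) (s.1 : Fin d → ℤ))) := by
      rw [offBlock_apply, if_neg hs]
      exact hA.2.2 (B4.inclIdx h r) s
    have hY : |colBlock h A⁻¹ s q| ≤
        c₁ * Real.exp (-(δ₁ * dist (s.1 : Fin d → ℤ) (q.1 : Fin d → ℤ))) := by
      rw [colBlock_apply]
      exact inv_decay hγ hc.le hδ hA s (B4.inclIdx h q)
    -- geometry: s lies in Λᶜ = Ω ∖ Λ
    have hsL : (s.1 : Fin d → ℤ) ∈ Lc := by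
      rw [hLc, Finset.coe_sdiff]
      exact ⟨s.1.2, by simpa using hs⟩
    set D₁ := dist (p.1 : Fin d → ℤ) (r.1 : Fin d → ℤ) with hD₁
    set D₂ := dist (r.1 : Fin d → ℤ) (s.1 : Fin d → ℤ) with hD₂
    set D₃ := dist (s.1 : Fin d → ℤ) (q.1 : Fin d → ℤ) with hD₃
    have hip : Metric.infDist (p.1 : Fin d → ℤ) Lc ≤ dist (p.1 : Fin d → ℤ) (s.1 : Fin d → ℤ) :=
      Metric.infDist_le_dist_of_mem hsL
    have hiq : Metric.infDist (q.1 : Fin d → ℤ) Lc ≤ dist (q.1 : Fin d → ℤ) (s.1 : Fin d → ℤ) :=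
      Metric.infDist_le_dist_of_mem hsL
    have t1 : dist (p.1 : Fin d → ℤ) (s.1 : Fin d → ℤ) ≤ D₁ + D₂ := dist_triangle _ _ _
    have t2 : dist (p.1 : Fin d → ℤ) (q.1 : Fin d → ℤ) ≤ D₁ + D₂ + D₃ := by
      have := dist_triangle (p.1 : Fin d → ℤ) (s.1 : Fin d → ℤ) (q.1 : Fin d → ℤ)
      linarith
    have t3 : dist (q.1 : Fin d → ℤ) (s.1 : Fin d → ℤ) = D₃ := dist_comm _ _
    have hTle : T ≤ 2 * (D₁ + D₂ + D₃) := by rw [hT]; linarith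
    have hsplit := exp_split hδ₁0 hδ₁δ₀ dist_nonneg hTle
    calc |(B4.compress h A)⁻¹ p r| * |offBlock h A r s| * |colBlock h A⁻¹ s q|
        ≤ c₁ * Real.exp (-(δ₁ * D₁)) * (c₀ * Real.exp (-(δ₀ * D₂))) * (c₁ * Real.exp (-(δ₁ * D₃))) := by
          apply mul_le_mul (mul_le_mul hX hM (abs_nonneg _) (by positivity)) hY (abs_nonneg _)
          positivity
      _ = c₁ * c₀ * c₁ * (Real.exp (-(δ₁ * D₁)) * Real.exp (-(δ₀ * D₂)) * Real.exp (-(δ₁ * D₃))) := by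
          ring
      _ ≤ c₁ * c₀ * c₁ *
          (Real.exp (-(δ₁ / 4 * T)) * Real.exp (-(δ₁ / 2 * D₁)) * Real.exp (-(δ₁ / 2 * D₃))) :=
          mul_le_mul_of_nonneg_left hsplit (by positivity)
      _ = W * Real.exp (-(δ₁ / 2 * D₁)) *
          Real.exp (-(δ₁ / 2 * dist (q.1 : Fin d → ℤ) (s.1 : Fin d → ℤ))) := by
          rw [t3, hW]; ring

end Blocks

/-! ## §6  (5.10): the second resolvent identity `A_Λ⁻¹ − (A+B)_Λ⁻¹ = A_Λ⁻¹ B_Λ (A+B)_Λ⁻¹` and its decay -/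

section Perturb

variable {d N : ℕ}

/-- `X⁻¹ − Y⁻¹ = X⁻¹(Y − X)Y⁻¹` for invertible matrices. [folklore] -/
theorem inv_sub_inv_eq {n : Type*} [Fintype n] [DecidableEq n] {X Y : Matrix n n ℝ}
    (hX : IsUnit X) (hY : IsUnit Y) : X⁻¹ - Y⁻¹ = X⁻¹ * (Y - X) * Y⁻¹ := by
  have hx := (Matrix.isUnit_iff_isUnit_det X).mp hX
  have hy := (Matrix.isUnit_iff_isUnit_det Y).mp hY
  rw [Matrix.mul_sub, Matrix.sub_mul, Matrix.mul_assoc X⁻¹ Y Y⁻¹, Matrix.mul_nonsing_inv Y hy,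
    Matrix.mul_one, Matrix.nonsing_inv_mul X hx, Matrix.one_mul]

/-- Compression is additive: `(A + B)_Λ − A_Λ = B_Λ`. [folklore] -/
theorem compress_add_sub {Ω Λ : Finset (Fin d → ℤ)} (h : Λ ⊆ Ω)
    (A B : Matrix (B4.Idx Ω N) (B4.Idx Ω N) ℝ) :
    B4.compress h (A + B) - B4.compress h A = B4.compress h B := by
  ext r q
  simp [B4.compress]

/-- **(5.10), uniformly in Ω and Λ**: under (5.6) for `A` and `A + B` and (5.9) for `B`,
`|A_Λ⁻¹(x,x′) − (A+B)_Λ⁻¹(x,x′)| ≤ c·e^{−(δ₁/4)(|x−x′| + dist(x,Ωᶜ) + dist(x′,Ωᶜ))}` with `c = bigConst`,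
`δ₁ = delta1`.  Mechanism: `inv_sub_inv_eq` (the p. 597 difference `A_Λ⁻¹ − (A+B)_Λ⁻¹` taken exactly rather than
through (5.24)), (5.9) for the middle factor, `dist(x,Ωᶜ) ≤ |x−y| + dist(y,Ωᶜ)`, (5.7) for the outer factors, §1.
[cite: Balaban1983RegularityDecay, (5.10) p.594] -/
theorem perturb_bound {γ₀ c₀ δ₀ : ℝ} (hγ : 0 < γ₀) (hc : 0 < c₀) (hδ : 0 < δ₀)
    {Ω : Finset (Fin d → ℤ)} {A B : Matrix (B4.Idx Ω N) (B4.Idx Ω N) ℝ} (hA : B4.Hyp56 Ω A γ₀ c₀ δ₀)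
    (hAB : B4.Hyp56 Ω (A + B) γ₀ c₀ δ₀) (hB : B4.Hyp59 Ω B c₀ δ₀)
    {Λ : Finset (Fin d → ℤ)} (h : Λ ⊆ Ω) (p q : B4.Idx Λ N) :
    |(B4.compress h A)⁻¹ p q - (B4.compress h (A + B))⁻¹ p q| ≤
      bigConst d N γ₀ c₀ δ₀ * Real.exp (-(delta1 d N γ₀ c₀ δ₀ / 4 *
        (dist (p.1 : Fin d → ℤ) (q.1 : Fin d → ℤ)
          + Metric.infDist (p.1 : Fin d → ℤ) ((Ω : Set (Fin d → ℤ)))ᶜ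
          + Metric.infDist (q.1 : Fin d → ℤ) ((Ω : Set (Fin d → ℤ)))ᶜ))) := by
  set δ₁ := delta1 d N γ₀ c₀ δ₀ with hδ₁
  set c₁ : ℝ := 2 / γ₀ with hc₁
  set K₁ : ℝ := N * latticeConst d (δ₁ / 2) with hK₁
  set Oc : Set (Fin d → ℤ) := ((Ω : Set (Fin d → ℤ)))ᶜ with hOc
  set T := dist (p.1 : Fin d → ℤ) (q.1 : Fin d → ℤ) + Metric.infDist (p.1 : Fin d → ℤ) Oc
    + Metric.infDist (q.1 : Fin d → ℤ) Oc with hT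
  have hδ₁pos : 0 < δ₁ := delta1_pos d N hγ hc.le hδ
  have hδ₁0 : 0 ≤ δ₁ := hδ₁pos.le
  have hδ₁δ₀ : δ₁ ≤ δ₀ := delta1_le_delta0 d N γ₀ c₀ hδ
  have hc₁0 : 0 ≤ c₁ := by rw [hc₁]; positivity
  have hAΛ : B4.Hyp56 Λ (B4.compress h A) γ₀ c₀ δ₀ := B6GOmega.hyp56_compress h hγ.le hc.le hδ.le hA
  have hABΛ : B4.Hyp56 Λ (B4.compress h (A + B)) γ₀ c₀ δ₀ :=
    B6GOmega.hyp56_compress h hγ.le hc.le hδ.le hAB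
  have entry : (B4.compress h A)⁻¹ p q - (B4.compress h (A + B))⁻¹ p q =
      ((B4.compress h A)⁻¹ * B4.compress h B * (B4.compress h (A + B))⁻¹) p q := by
    have e := inv_sub_inv_eq (isUnit_of_hyp56 hγ hAΛ) (isUnit_of_hyp56 hγ hABΛ)
    rw [compress_add_sub] at e
    have e' := congrFun (congrFun e p) q
    rw [Matrix.sub_apply] at e'
    exact e'
  rw [entry]
  refine (abs_mul3_apply_le _ _ _ p q).trans ?_
  set W := c₁ * c₀ * c₁ * Real.exp (-(δ₁ / 4 * T)) with hW
  have hW0 : 0 ≤ W := by rw [hW]; positivity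
  have main := sum_sum_le_of_factor
    (fun (r : B4.Idx Λ N) (s : B4.Idx Λ N) =>
      |(B4.compress h A)⁻¹ p r| * |B4.compress h B r s| * |(B4.compress h (A + B))⁻¹ s q|)
    (fun r : B4.Idx Λ N => Real.exp (-(δ₁ / 2 * dist (p.1 : Fin d → ℤ) (r.1 : Fin d → ℤ))))
    (fun s : B4.Idx Λ N => Real.exp (-(δ₁ / 2 * dist (q.1 : Fin d → ℤ) (s.1 : Fin d → ℤ))))
    (W := W) (Ka := K₁) (Kb := K₁) hW0 (fun r => (Real.exp_pos _).le) (fun s => (Real.exp_pos _).le)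
    ?_ (idxSum_le (half_pos hδ₁pos) Λ _) (idxSum_le (half_pos hδ₁pos) Λ _)
  · refine main.trans (le_of_eq ?_)
    rw [hW]; unfold bigConst; rw [← hδ₁, ← hK₁]; ring
  intro r s
  have hX := inv_compress_decay hγ hc.le hδ hA h p r
  have hM : |B4.compress h B r s| ≤ c₀ * Real.exp (-(δ₀ * (dist (r.1 : Fin d → ℤ) (s.1 : Fin d → ℤ)
      + Metric.infDist (r.1 : Fin d → ℤ) Oc + Metric.infDist (s.1 : Fin d → ℤ) Oc))) := by
    simp only [B4.compress, Matrix.submatrix_apply]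
    exact hB (B4.inclIdx h r) (B4.inclIdx h s)
  have hY := inv_compress_decay hγ hc.le hδ hAB h s q
  set D₁ := dist (p.1 : Fin d → ℤ) (r.1 : Fin d → ℤ) with hD₁
  set D₃ := dist (s.1 : Fin d → ℤ) (q.1 : Fin d → ℤ) with hD₃
  set ur := Metric.infDist (r.1 : Fin d → ℤ) Oc with hur
  set us := Metric.infDist (s.1 : Fin d → ℤ) Oc with hus
  set D₂ := dist (r.1 : Fin d → ℤ) (s.1 : Fin d → ℤ) + ur + us with hD₂
  have hur0 : 0 ≤ ur := Metric.infDist_nonneg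
  have hus0 : 0 ≤ us := Metric.infDist_nonneg
  have hD₂0 : 0 ≤ D₂ := by rw [hD₂]; positivity
  have hip : Metric.infDist (p.1 : Fin d → ℤ) Oc ≤ ur + D₁ := by
    rw [hur, hD₁]; exact Metric.infDist_le_infDist_add_dist
  have hiq : Metric.infDist (q.1 : Fin d → ℤ) Oc ≤ us + dist (q.1 : Fin d → ℤ) (s.1 : Fin d → ℤ) := by
    rw [hus]; exact Metric.infDist_le_infDist_add_dist
  have t2 : dist (p.1 : Fin d → ℤ) (q.1 : Fin d → ℤ) ≤
      D₁ + dist (r.1 : Fin d → ℤ) (s.1 : Fin d → ℤ) + D₃ := by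
    have := dist_triangle (p.1 : Fin d → ℤ) (r.1 : Fin d → ℤ) (q.1 : Fin d → ℤ)
    have := dist_triangle (r.1 : Fin d → ℤ) (s.1 : Fin d → ℤ) (q.1 : Fin d → ℤ)
    linarith
  have t3 : dist (q.1 : Fin d → ℤ) (s.1 : Fin d → ℤ) = D₃ := dist_comm _ _
  have hrs0 : 0 ≤ dist (r.1 : Fin d → ℤ) (s.1 : Fin d → ℤ) := dist_nonneg
  have hTle : T ≤ 2 * (D₁ + D₂ + D₃) := by rw [hT, hD₂]; linarith
  have hsplit := exp_split hδ₁0 hδ₁δ₀ hD₂0 hTle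
  calc |(B4.compress h A)⁻¹ p r| * |B4.compress h B r s| * |(B4.compress h (A + B))⁻¹ s q|
      ≤ c₁ * Real.exp (-(δ₁ * D₁)) * (c₀ * Real.exp (-(δ₀ * D₂))) * (c₁ * Real.exp (-(δ₁ * D₃))) := by
        apply mul_le_mul (mul_le_mul hX hM (abs_nonneg _) (by positivity)) hY (abs_nonneg _)
        positivity
    _ = c₁ * c₀ * c₁ * (Real.exp (-(δ₁ * D₁)) * Real.exp (-(δ₀ * D₂)) * Real.exp (-(δ₁ * D₃))) := by
        ring
    _ ≤ c₁ * c₀ * c₁ *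
        (Real.exp (-(δ₁ / 4 * T)) * Real.exp (-(δ₁ / 2 * D₁)) * Real.exp (-(δ₁ / 2 * D₃))) :=
        mul_le_mul_of_nonneg_left hsplit (by positivity)
    _ = W * Real.exp (-(δ₁ / 2 * D₁)) *
        Real.exp (-(δ₁ / 2 * dist (q.1 : Fin d → ℤ) (s.1 : Fin d → ℤ))) := by
        rw [t3, hW]; ring

end Perturb

/-! ## §7  The Sect. 5 Theorem of [3], kernel-proved (uniform reading ⇒ literal reading ⇒ the B4 leaf) -/

section Main

/-- The uniform constant `c₁* = max{2/γ₀, bigConst}` of the theorem. [folklore] -/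
noncomputable def cStar (d N : ℕ) (γ₀ c₀ δ₀ : ℝ) : ℝ := max (2 / γ₀) (bigConst d N γ₀ c₀ δ₀)

/-- The uniform rate `δ₁* = delta1/4` of the theorem. [folklore] -/
noncomputable def deltaStar (d N : ℕ) (γ₀ c₀ δ₀ : ℝ) : ℝ := delta1 d N γ₀ c₀ δ₀ / 4

/-- `c₁* > 0`. [folklore] -/
theorem cStar_pos (d N : ℕ) {γ₀ : ℝ} (c₀ δ₀ : ℝ) (hγ : 0 < γ₀) : 0 < cStar d N γ₀ c₀ δ₀ :=
  lt_max_of_lt_left (by positivity)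

/-- `δ₁* > 0`. [folklore] -/
theorem deltaStar_pos (d N : ℕ) {γ₀ c₀ δ₀ : ℝ} (hγ : 0 < γ₀) (hc : 0 ≤ c₀) (hδ : 0 < δ₀) :
    0 < deltaStar d N γ₀ c₀ δ₀ := by
  unfold deltaStar; have := delta1_pos d N hγ hc hδ; positivity

/-- **The Sect. 5 Theorem with explicit uniform constants**: for `(γ₀, c₀, δ₀)` the pair `(cStar, deltaStar)`
(functions of `γ₀, c₀, δ₀, d, N` only) serves (5.7), (5.8) and (5.10) for every finite `Ω ⊂ ℤ^d`, every `A` with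
(5.6), every `Λ ⊆ Ω` and every admissible perturbation `B`. [cite: Balaban1983RegularityDecay, Sect. 5 Theorem (5.6)–(5.10) p.594] -/
theorem sect5_explicit (d N : ℕ) {γ₀ c₀ δ₀ : ℝ} (hγ : 0 < γ₀) (hc : 0 < c₀) (hδ : 0 < δ₀)
    (Ω : Finset (Fin d → ℤ)) (A : Matrix (B4.Idx Ω N) (B4.Idx Ω N) ℝ) (hA : B4.Hyp56 Ω A γ₀ c₀ δ₀) :
    (∀ (Λ : Finset (Fin d → ℤ)) (h : Λ ⊆ Ω),
        B4.Concl57_58 Ω Λ h A (cStar d N γ₀ c₀ δ₀) (deltaStar d N γ₀ c₀ δ₀)) ∧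
    (∀ B : Matrix (B4.Idx Ω N) (B4.Idx Ω N) ℝ, B4.Hyp56 Ω (A + B) γ₀ c₀ δ₀ → B4.Hyp59 Ω B c₀ δ₀ →
      ∀ (Λ : Finset (Fin d → ℤ)) (h : Λ ⊆ Ω),
        B4.Concl510 Ω Λ h A B (cStar d N γ₀ c₀ δ₀) (deltaStar d N γ₀ c₀ δ₀)) := by
  have hδ₁ := delta1_pos d N hγ hc.le hδ
  have h2γ : (0 : ℝ) ≤ 2 / γ₀ := by positivity
  have hbig := bigConst_nonneg d N hγ hc.le hδ
  have hrate1 : deltaStar d N γ₀ c₀ δ₀ ≤ delta1 d N γ₀ c₀ δ₀ := by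
    unfold deltaStar; linarith
  have hrate2 : deltaStar d N γ₀ c₀ δ₀ ≤ delta1 d N γ₀ c₀ δ₀ / 4 := le_rfl
  refine ⟨fun Λ h => ⟨fun p q => ?_, fun p q => ?_⟩, fun B hAB hB Λ h p q => ?_⟩
  · exact (inv_compress_decay hγ hc.le hδ hA h p q).trans
      (weaken h2γ (le_max_left _ _) hrate1 dist_nonneg)
  · refine (deltaC_bound hγ hc hδ hA h p q).trans (weaken hbig (le_max_right _ _) hrate2 ?_)
    have := Metric.infDist_nonneg (x := (p.1 : Fin d → ℤ))
      (s := (((Ω \ Λ : Finset (Fin d → ℤ))) : Set (Fin d → ℤ)))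
    have := Metric.infDist_nonneg (x := (q.1 : Fin d → ℤ))
      (s := (((Ω \ Λ : Finset (Fin d → ℤ))) : Set (Fin d → ℤ)))
    have : 0 ≤ dist (p.1 : Fin d → ℤ) (q.1 : Fin d → ℤ) := dist_nonneg
    linarith
  · refine (perturb_bound hγ hc hδ hA hAB hB h p q).trans (weaken hbig (le_max_right _ _) hrate2 ?_)
    have := Metric.infDist_nonneg (x := (p.1 : Fin d → ℤ)) (s := ((Ω : Set (Fin d → ℤ)))ᶜ)
    have := Metric.infDist_nonneg (x := (q.1 : Fin d → ℤ)) (s := ((Ω : Set (Fin d → ℤ)))ᶜ)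
    have : 0 ≤ dist (p.1 : Fin d → ℤ) (q.1 : Fin d → ℤ) := dist_nonneg
    linarith

/-- **THE SECT. 5 THEOREM OF [3] IS A THEOREM** (uniform reading, surge node T01.4): the leaf Prop
`B4.Sect5ThmUniform d N` holds for all `d, N`. [cite: Balaban1983RegularityDecay, Sect. 5 Theorem p.594 + p.597] -/
theorem sect5ThmUniform_holds (d N : ℕ) : B4.Sect5ThmUniform d N := by
  intro γ₀ c₀ δ₀ hγ hc hδ
  exact ⟨cStar d N γ₀ c₀ δ₀, deltaStar d N γ₀ c₀ δ₀, cStar_pos d N c₀ δ₀ hγ,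
    deltaStar_pos d N hγ hc.le hδ, fun Ω A hA => sect5_explicit d N hγ hc hδ Ω A hA⟩

variable (d N : ℕ) in
/-- `Sect5ThmUniform` — `_holds` alias of `sect5ThmUniform_holds` above under the fact's exact name, stated under the
prover's own binders as section variables (appended 2026-08-28, D-0026 bookkeeping: the proof term is the
existing theorem of this file; no statement, definition or attribute is edited; no new named fact; the
ledger's debt table listed the fact unproved). [cite: Balaban1983RegularityDecay, Sect. 5 Theorem p.594 + p.597] -/
theorem _root_.Literature.MathematicalPhysics.QuantumFieldTheory.Balaban1983to89.B4.Sect5ThmUniform_holds :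
    _root_.Literature.MathematicalPhysics.QuantumFieldTheory.Balaban1983to89.B4.Sect5ThmUniform d N :=
  _root_.Literature.MathematicalPhysics.QuantumFieldTheory.Balaban1983to89.B4Sect5Proof.sect5ThmUniform_holds (d := d) (N := N)

/-- The literal quantifier reading follows. [cite: Balaban1983RegularityDecay, Sect. 5 Theorem (5.6)–(5.10) p.594] -/
theorem sect5ThmLiteral_holds (d N : ℕ) : B4.Sect5ThmLiteral d N :=
  B4.sect5_literal_of_uniform (sect5ThmUniform_holds d N)

variable (d N : ℕ) in
/-- `Sect5ThmLiteral` — `_holds` alias of `sect5ThmLiteral_holds` above under the fact's exact name, stated under the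
prover's own binders as section variables (appended 2026-08-28, D-0026 bookkeeping: the proof term is the
existing theorem of this file; no statement, definition or attribute is edited; no new named fact; the
ledger's debt table listed the fact unproved). [cite: Balaban1983RegularityDecay, Sect. 5 Theorem (5.6)–(5.10) p.594] -/
theorem _root_.Literature.MathematicalPhysics.QuantumFieldTheory.Balaban1983to89.B4.Sect5ThmLiteral_holds :
    _root_.Literature.MathematicalPhysics.QuantumFieldTheory.Balaban1983to89.B4.Sect5ThmLiteral d N :=
  _root_.Literature.MathematicalPhysics.QuantumFieldTheory.Balaban1983to89.B4Sect5Proof.sect5ThmLiteral_holds (d := d) (N := N)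

/-- The B4 leaf of the series DAG now rests on THREE printed statements (Theorem p. 573, Prop. 2.3 of [1], Prop. 3.1′
of [2]); its fourth conjunct is proved. [cite: Balaban1983RegularityDecay, Theorem p.573, Props. p.574] -/
theorem leafB4_of_printed {I₁ I₂ I₃ : Type} {famE : I₁ → B4.EtaSetting} {famU : I₂ → B4.UnitSetting}
    {famF : I₃ → B4.FormSetting} {d N : ℕ} (h₁ : B4.ThmPrinted famE) (h₂ : B4.Prop23Printed famU)
    (h₃ : B4.Prop31Printed famF) : B4.LeafB4 famE famU famF d N :=
  B4.leafB4_intro h₁ h₂ h₃ (sect5ThmUniform_holds d N)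

/-- Consumer side, B6 use sites (unit b06 / pv09 lineages): the unit-lattice ENGINE of `B6FromB4` is unconditional.
[cite: Balaban1984PropagatorsII, p.250] -/
theorem unitLatticeEngine (d N : ℕ) : B6FromB4.UnitLatticeEngine d N :=
  B6FromB4.engine_of_sect5Uniform (sect5ThmUniform_holds d N)

/-- `B6FromB4.UnitLatticeEngine` holds for all parameters — `_holds` alias of `unitLatticeEngine`
above (appended 2026-08-28, D-0026 bookkeeping: the proof term is the existing theorem of this
file; no statement, definition or attribute is edited; no new named fact).
[cite: Balaban1984PropagatorsII, p.250] -/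
theorem _root_.Literature.MathematicalPhysics.QuantumFieldTheory.Balaban1983to89.B6FromB4.UnitLatticeEngine_holds (d N : ℕ) :
    B6FromB4.UnitLatticeEngine d N :=
  unitLatticeEngine d N

/-- Consumer side: the cut-cube uniformity of `B6GOmega` is unconditional. [cite: Balaban1984PropagatorsII, p.228 + p.248] -/
theorem cutFamilyUniform (d N : ℕ) : B6GOmega.CutFamilyUniform d N :=
  B6GOmega.cutFamily_uniform (sect5ThmUniform_holds d N)

/-- `B6GOmega.CutFamilyUniform` holds for all parameters — `_holds` alias of `cutFamilyUniform`
above (appended 2026-08-28, D-0026 bookkeeping: the proof term is the existing theorem of this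
file; no statement, definition or attribute is edited; no new named fact).
[cite: Balaban1984PropagatorsII, p.228 + p.248] -/
theorem _root_.Literature.MathematicalPhysics.QuantumFieldTheory.Balaban1983to89.B6GOmega.CutFamilyUniform_holds (d N : ℕ) :
    B6GOmega.CutFamilyUniform d N :=
  cutFamilyUniform d N

end Main

end Literature.MathematicalPhysics.QuantumFieldTheory.Balaban1983to89.B4Sect5Proof
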